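import Mathlib
import Literature.NumberTheory.Sieve.PolynomialCongruences
import Summits.Parity.BatemanHorn.Theses.RoughValueTransport

/-!
# Sketch — crux-ideate stmt-Parity-9469 (BalancedSemiprimeLayer), ideator 3, round 1

First lemmas of the two idea cards (they only need to ELABORATE; no proofs here).
-/

namespace Summit.Parity.BatemanHorn.Cruxes.BalancedSemiprimeLayer.Ideator3

open scoped BigOperators
open Polynomial Literature.NumberTheory.Sieve

/-- Card `smooth-modulus-twisted-hooley`, FIRST LEMMA (= the one beyond-x input of the line,
model discriminant form): Hooley-1963-type POWER saving for the root Weyl sums of the DILATED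
quadratic `Q²X² − D` over moduli `m ≤ M` in a fixed progression `m ≡ a (mod Q)`, `(m, Q) = 1`,
with losses polynomial in `Q` and `h`.  (`S_{X²−D}(h·Q̄; m) = S_{Q²X²−D}(h; m)` for `(m,Q)=1`, so this
is the `Q̄`-twisted Hooley sum that the complete divisor family of the quadratic layer needs at
moduli `Q·m ≤ x^{1+γ₀}`.) -/
def TwistedHooleyDilates : Prop :=
  ∀ D : ℤ, ¬ IsSquare D → ∃ η : ℝ, 0 < η ∧ ∃ A K : ℝ, ∀ (Q : ℕ) (a : ℕ) (h : ℤ) (M : ℕ),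
    0 < Q → h ≠ 0 → 2 ≤ M →
      ‖∑ m ∈ (Finset.Icc 1 M).filter (fun m : ℕ => m ≡ a [MOD Q] ∧ m.Coprime Q),
          polyRootWeylSum (C ((Q : ℤ) ^ 2) * X ^ 2 - C D) m h‖ ≤
        K * (Q : ℝ) ^ A * |(h : ℝ)| ^ A * (M : ℝ) ^ (1 - η)

/-- Card `sector-width-budget`, FIRST LEMMA (model case `X²+1`, the Lagrange/Gauss dictionary as an
INEQUALITY): every `n ≤ x` with `n²+1` composite and `x^{1−δ}`-rough (`δ ≤ 1/4`) is `n = ac − bd` for a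
matrix `(a, −b; c, d)` of determinant `ad + bc = 1` whose row norms `a²+b² ≤ c²+d²` are the two
(prime) factors, the smaller one `≥ x^{1−δ}`; so the boundary layer of the system `(X²+1)` is at most
the number of such SL₂(ℤ)-points — the objects the affine upper-bound sieve counts in `x^δ`-skew
sectors. -/
def LagrangeLayerBound : Prop :=
  ∀ δ : ℝ, 0 < δ → δ ≤ 1 / 4 → ∀ x : ℕ, 16 ≤ x →
    (((Finset.Icc 1 x).filter (fun n : ℕ =>
        (∀ p ∈ Finset.range ⌈(x : ℝ) ^ (1 - δ)⌉₊, p.Prime → ¬ (p ∣ n ^ 2 + 1)) ∧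
          ¬ (n ^ 2 + 1).Prime)).card : ℝ) ≤
      (((Finset.Icc (-(2 * x : ℤ)) (2 * x) ×ˢ Finset.Icc (-(2 * x : ℤ)) (2 * x) ×ˢ
            Finset.Icc (-(2 * x : ℤ)) (2 * x) ×ˢ Finset.Icc (-(2 * x : ℤ)) (2 * x)).filter
          (fun q : ℤ × ℤ × ℤ × ℤ =>
            q.1 * q.2.2.2 + q.2.1 * q.2.2.1 = 1 ∧
              (x : ℝ) ^ (1 - δ) ≤ ((q.1 ^ 2 + q.2.1 ^ 2 : ℤ) : ℝ) ∧
                q.1 ^ 2 + q.2.1 ^ 2 ≤ q.2.2.1 ^ 2 + q.2.2.2 ^ 2 ∧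
                  |q.1 * q.2.2.1 - q.2.1 * q.2.2.2| ≤ (x : ℤ) ∧
                    (q.1 ^ 2 + q.2.1 ^ 2).natAbs.Prime ∧
                      (q.2.2.1 ^ 2 + q.2.2.2 ^ 2).natAbs.Prime)).card : ℝ)

/-- Sanity: the crux decl is in scope under its route name (the line must conclude THIS). -/
example : Prop := Summit.Parity.BatemanHorn.Theses.RoughValueTransport.BalancedSemiprimeLayer

end Summit.Parity.BatemanHorn.Cruxes.BalancedSemiprimeLayer.Ideator3
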